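import Literature.Geometry.Riemannian.BoundaryMetricExtensionCollar
import HarnessLib

/-!
# The slices `Σ × {t}` of the quasi-spherical cylinder `(Σ × [0, 1], u² dt² + γ_t)`

Topic `Literature/Geometry/Riemannian`; continuation of `BoundaryMetricExtensionCollar.lean`
(the cylinder metric `lapseCylinderMetric γ₀ γ₁ u = u² dt² + γ_t` of Shi–Wang–Wei, J. reine
angew. Math. 784 (2022), Claim 2.1 / proof of Lemma 2.1, the step (2) object of the named fact
`ShiWangWei2022_boundaryMetric_extends_psc` of `BoundaryMetricExtension.lean`). Here the slices
`Σ_t = Σ × {t}` are set up as hypersurfaces in the vocabulary of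
`Literature/Geometry/Lorentzian/Hypersurface.lean` (spacelike immersions, induced metrics, unit
normal fields), as in the first lines of the proof of Claim 2.1 ("Let `Ā_t`, `H̄_t` be the second
fundamental form and the mean curvature of `Σ_t` … with respect to the `∂_t`-direction … where
`ν = u⁻¹ ∂_t`"):

* `isSpacelikeImmersion_cylinderSlice` — the slice embedding `z ↦ (z, t)` is a spacelike
  immersion into `(Σ × [0,1], u² dt² + γ_t)`;
* `inducedMetric_cylinderSlice` — **its induced metric is `γ_t = (1 - t) γ₀ + t γ₁`**
  (`PseudoRiemannianMetric.linePath`), as pseudo-Riemannian metrics;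
* `cylinderSliceNormal u t` — the field `ν = u⁻¹ ∂_t` along the slice, `ν z = (0, u(z,t)⁻¹ · 1)`
  with Mathlib's unit tangent vector `1` of the segment, and `isUnitNormal_cylinderSliceNormal` —
  **`ν` is a unit normal of sign `+1`** (`g(ν, dι v) = 0`, `g(ν, ν) = 1`).

Everything is proved; no named facts. NOT here: smoothness of `ν` as a field into the tangent
bundle of the cylinder, the second fundamental form `A_t = u⁻¹ Ā_t`, `Ā_t = ½ γ_t'` and the
curvature identities of Claim 2.1 (they need the Levi-Civita connection of `u² dt² + γ_t`).

## References

* Y. Shi, W. Wang, G. Wei, *Total mean curvature of the boundary and nonnegative scalar curvature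
  fill-ins*, J. reine angew. Math. 784 (2022) 215–250 = arXiv:2007.06756, §2, Claim 2.1 and its
  proof (p. 6 of the arXiv text). [ShiWangWei2022]
* B. O'Neill, *Semi-Riemannian geometry with applications to relativity* (1983), Ch. 4, pp. 97–98,
  106–107 (induced metric, normal fields, sign of a hypersurface). [ONeill1983]
-/

noncomputable section

open Bundle Set Function
open scoped Manifold ContDiff Topology

namespace Literature.Geometry.Riemannian

open Lorentzian Lorentzian.PseudoRiemannianMetric

/-! ### The slices `Σ × {t}` as spacelike hypersurfaces with unit normal `ν = u⁻¹ ∂_t` -/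

section SliceNormal

variable {ES : Type*} [NormedAddCommGroup ES] [NormedSpace ℝ ES] {HS : Type*}
  [TopologicalSpace HS] {IS : ModelWithCorners ℝ ES HS} {S : Type*} [TopologicalSpace S]
  [ChartedSpace HS S] [IsManifold IS ∞ S]
  (γ₀ γ₁ : PseudoRiemannianMetric IS ∞ ES (TangentSpace IS : S → Type _))
  (u : S × Icc (0 : ℝ) 1 → ℝ)

/-- `(u² dt² + γ_t)((0, b), (v, 0)) = 0` (symmetric form of `lapseCylinderMetric_apply_inl_inr`).
[cite: ShiWangWei2022, Claim 2.1] -/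
theorem lapseCylinderMetric_apply_inr_inl (h₀ : γ₀.IsRiemannian) (h₁ : γ₁.IsRiemannian)
    (hu : ContMDiff (IS.prod (𝓡∂ 1)) 𝓘(ℝ) ∞ u) (hu0 : ∀ p, u p ≠ 0) (p : S × Icc (0 : ℝ) 1)
    (b : TangentSpace (𝓡∂ 1) p.2) (v : TangentSpace IS p.1) :
    (lapseCylinderMetric γ₀ γ₁ u h₀ h₁ hu hu0).val p
      ((0, b) : TangentSpace (IS.prod (𝓡∂ 1)) p) ((v, 0) : TangentSpace (IS.prod (𝓡∂ 1)) p) =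
      0 := by
  rw [(lapseCylinderMetric γ₀ γ₁ u h₀ h₁ hu hu0).symm]
  exact lapseCylinderMetric_apply_inl_inr γ₀ γ₁ u h₀ h₁ hu hu0 p v b

omit [IsManifold IS ∞ S] in
/-- **The slice embedding `z ↦ (z, t)` is `C^∞`.** [folklore] -/
theorem contMDiff_cylinderSlice (t : Icc (0 : ℝ) 1) :
    ContMDiff IS (IS.prod (𝓡∂ 1)) ∞ (cylinderSlice (S := S) t) :=
  contMDiff_id.prodMk contMDiff_const

/-- **The slices are spacelike hypersurfaces**: `z ↦ (z, t)` is a spacelike immersion into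
`(Σ × [0,1], u² dt² + γ_t)`, its induced form being `γ_t`, which is positive definite.
[cite: ShiWangWei2022, Claim 2.1] -/
theorem isSpacelikeImmersion_cylinderSlice (h₀ : γ₀.IsRiemannian) (h₁ : γ₁.IsRiemannian)
    (hu : ContMDiff (IS.prod (𝓡∂ 1)) 𝓘(ℝ) ∞ u) (hu0 : ∀ p, u p ≠ 0) (t : Icc (0 : ℝ) 1) :
    (lapseCylinderMetric γ₀ γ₁ u h₀ h₁ hu hu0).IsSpacelikeImmersion IS (cylinderSlice t) := by
  refine ⟨contMDiff_cylinderSlice t, fun z v hv ↦ ?_⟩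
  rw [inducedBilin]
  show 0 < pullbackBilin (I := IS.prod (𝓡∂ 1)) (I' := IS) (cylinderSlice t)
    (lapseCylinderMetric γ₀ γ₁ u h₀ h₁ hu hu0).val z v v
  rw [pullbackBilin_cylinderSlice_lapseCylinderMetric]
  exact isRiemannian_linePath γ₀ γ₁ h₀ h₁ t t.2 z v hv

/-- **The metric induced on the slice `Σ × {t}` is `γ_t`** as pseudo-Riemannian metrics
(`inducedMetric` of the slice embedding `=` `linePath γ₀ γ₁ t`). [cite: ShiWangWei2022, Claim 2.1] -/
theorem inducedMetric_cylinderSlice (h₀ : γ₀.IsRiemannian) (h₁ : γ₁.IsRiemannian)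
    (hu : ContMDiff (IS.prod (𝓡∂ 1)) 𝓘(ℝ) ∞ u) (hu0 : ∀ p, u p ≠ 0) (t : Icc (0 : ℝ) 1)
    [FiniteDimensional ℝ ES] :
    (lapseCylinderMetric γ₀ γ₁ u h₀ h₁ hu hu0).inducedMetric (cylinderSlice t)
        contMDiff_pullbackBilin_holds
        (isSpacelikeImmersion_cylinderSlice γ₀ γ₁ u h₀ h₁ hu hu0 t) =
      γ₀.linePath γ₁ h₀ h₁ t t.2 := by
  ext z v w
  exact pullbackBilin_cylinderSlice_lapseCylinderMetric γ₀ γ₁ u h₀ h₁ hu hu0 t z v w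

/-- **The field `ν = u⁻¹ ∂_t` along the slice `Σ × {t}`**, `ν z = (0, u(z,t)⁻¹ · 1) ∈
T_{(z,t)}(Σ × [0,1])` (Mathlib's unit tangent vector `1` of the segment): the unit normal of
the slices in `(Σ × [0,1], u² dt² + γ_t)` ("where `ν = u⁻¹ ∂_t`", proof of Claim 2.1;
`isUnitNormal_cylinderSliceNormal`). [cite: ShiWangWei2022, proof of Claim 2.1] -/
def cylinderSliceNormal (t : Icc (0 : ℝ) 1) :
    NormalField (IS.prod (𝓡∂ 1)) (cylinderSlice (S := S) t) :=
  fun z ↦ ((0, (u (z, t))⁻¹ • (1 : TangentSpace (𝓡∂ 1) t)) :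
    TangentSpace (IS.prod (𝓡∂ 1)) (z, t))

omit [IsManifold IS ∞ S] in
/-- `ν z = (0, u(z,t)⁻¹ · 1)`. [cite: ShiWangWei2022, proof of Claim 2.1] -/
@[simp] theorem cylinderSliceNormal_apply (t : Icc (0 : ℝ) 1) (z : S) :
    cylinderSliceNormal (IS := IS) u t z =
      ((0, (u (z, t))⁻¹ • (1 : TangentSpace (𝓡∂ 1) t)) :
        TangentSpace (IS.prod (𝓡∂ 1)) (z, t)) := rfl

/-- **`ν = u⁻¹ ∂_t` is a unit normal (sign `+1`) of the slice `Σ × {t}`** in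
`(Σ × [0,1], u² dt² + γ_t)`: it is orthogonal to the slice (`lapseCylinderMetric_apply_inr_inl`,
the differential of the slice embedding being `v ↦ (v, 0)`) and `g(ν, ν) = u² · u⁻² = 1`
(`lapseCylinderMetric_apply_inr_inr`). [cite: ShiWangWei2022, proof of Claim 2.1] -/
theorem isUnitNormal_cylinderSliceNormal (h₀ : γ₀.IsRiemannian) (h₁ : γ₁.IsRiemannian)
    (hu : ContMDiff (IS.prod (𝓡∂ 1)) 𝓘(ℝ) ∞ u) (hu0 : ∀ p, u p ≠ 0) (t : Icc (0 : ℝ) 1) :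
    (lapseCylinderMetric γ₀ γ₁ u h₀ h₁ hu hu0).IsUnitNormal IS (cylinderSlice t)
      (cylinderSliceNormal u t) 1 := by
  refine ⟨fun z v ↦ ?_, fun z ↦ ?_⟩
  · have hd : mfderiv IS (IS.prod (𝓡∂ 1)) (cylinderSlice (S := S) t) z =
        ContinuousLinearMap.inl ℝ (TangentSpace IS z) (TangentSpace (𝓡∂ 1) t) :=
      mfderiv_prod_left
    rw [hd]
    exact lapseCylinderMetric_apply_inr_inl γ₀ γ₁ u h₀ h₁ hu hu0 (z, t) _ v
  · show (lapseCylinderMetric γ₀ γ₁ u h₀ h₁ hu hu0).val (z, t)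
        ((0, (u (z, t))⁻¹ • (1 : TangentSpace (𝓡∂ 1) t)) : TangentSpace (IS.prod (𝓡∂ 1)) (z, t))
        ((0, (u (z, t))⁻¹ • (1 : TangentSpace (𝓡∂ 1) t)) : TangentSpace (IS.prod (𝓡∂ 1)) (z, t))
        = 1
    rw [lapseCylinderMetric_apply_inr_inr]
    have hu' : u (z, t) ≠ 0 := hu0 (z, t)
    field_simp

end SliceNormal

end Literature.Geometry.Riemannian

end
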